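import Summits.QuantumFields.YangMills.Theorems.BalabanUVNodesK1R8RowsDefs
import Summits.QuantumFields.BalabanUV.Beta.EriceFlowEnclosureB12AsPrintedPointwiseFadingZeroHistoryBoundary

/-!
# BalabanUVNodes ∕ K1⁹ `StabilityBRunRowsAtRecordR13SepCoPHV` (stmt-QuantumFields-27364, crux r3 DECIDING, route rev 28; rows conjunct slot-free = K1⁸ 26907's `RunRowsCont13 F θ`) —
# THE ROWS AT THE BOUNDARY `b⋆ = 0` AND THEIR PRICE AT THE TUPLE, from node U2's letters on the record's β

β-flow team (pub-balaban), PROVER 2 = lower ∕ positivity side (unit `b2b-balaban-beta-bflow-p2`, gen 51), `--kind proof --supports stmt-QuantumFields-27364` (helper); COUNT-NEUTRAL.  The kernels are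
the β-flow team's part 13 `Summits/QuantumFields/BalabanUV/Beta/EriceFlowEnclosureB12AsPrintedPointwiseFadingZeroHistory{,Boundary}` (the zero-history values `b⁰` of an ABSTRACT `β : FlowStep.HBeta`,
the boundary `b⋆ = 0` decided by the history term) and part 12d `…RunRowsNecessity`; THIS FILE keys them to the record's β `β_θ := Node00.betaOfRecord₁₃ F 2 θ.toStage13Params` at a Stage-13 tuple
and reads the result into DEF-1's name `RunRowsCont13 F θ` BY NAME (`runRowsCont13_iff_inline` is `Iff.rfl`; nothing of DEF-1's, dag-n24's, dag-n17's, b2b-an4's or gen 50's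
`…BalabanUVNodesK1RunRowsOfU2Letters` is restated or modified).  K1⁹'s rows conjunct is the SAME text as K1⁸'s (the version slot `v` enters only (B) and the window), so every road below serves
the deciding crux verbatim.

WHAT IS NEW RELATIVE TO GEN 50's `…K1RunRowsOfU2Letters` (roads (α) runs ∕ (β) NE4 + `b⋆ > 0` ∕ (γ) eventual letter ∕ as-printed).  (δ) THE BOUNDARY ROAD: under the moduli + NE4 + the record's
zero-history values `b⁰` + its asymptotic constant `b⋆ ≥ 0` (ZERO ALLOWED) and a ONE-SIDED letter on the history term — `β_θ,k+1(v) − b⁰_k ≥ −e_k` on a box from scale k₀ on with `Σ e_k ≤ E`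
(`e ≡ 0`: «β_θ is minimised at the zero history», a one-sided (AF-1)) — `RunRowsCont13 F θ` holds (`runRowsCont13_of_histNegSummable`).  (β′) THE DOUBLED LEVEL: with `b⋆` the rows hold
at every level `0 < δ ≤ γ` with `Cδ ≤ b⋆(1−ρ)` (gen 50: `2Cδ ≤ b⋆(1−ρ)`), the remainder sequence being the INTRINSIC `b⁰` with radius `Cδ∕(1−ρ)` (`runRowsCont13_of_moduli_NE4_at_level'`).
(ν) THE PRICE: conversely `RunRowsCont13 F θ` + the letters force `0 ≤ b⋆` (`bstar_nonneg_of_runRowsCont13`, part 12d BY NAME) — gen 50's OPEN (a), filed now that the boundary is decided: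
at the tuple, under the letters, the deciding crux's rows are `b⋆ > 0`-SUFFICIENT, `b⋆ ≥ 0`-NECESSARY, and AT `b⋆ = 0` EQUIVALENT to the run-wise floor of the history term (part 13b §1).

HONEST FRAMING.  SUPPORT-class bookkeeping BY NAME, CONDITIONAL on node U2's HYPOTHESIS SHAPES `T4CouplingMatching.HistLipschitz ∕ FadingMemory ∕ ScaleShiftRate` for `β_θ` (NOT printed —
[Balaban1987RG1] p. 298 ∕ p. 264; GAPS G-t4-U2-1∕2), on DISPLAYED properties `hb0` ∕ `hb` (part 13 ∕ part 11 supply them FROM the letters — `exists_zeroHist`, `exists_bstar`) and on a DISPLAYED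
one-sided envelope; inhabited here at NO θ.  NO stub of K1 «v8» is proved (the rows at the WITNESS for Bałaban's β are [II] (2.41)-class content); K0⁷ ∕ K1⁹ ∕ K3⁷ OPEN; counts unmoved.
Discharges NOTHING of BetaPertH; NOT [I] Thm 2; NOT continuum; NOT Clay.  HONEST DEPENDENCY (cell reorg 2026-08-19, verbatim): «continuum YM on T⁴ ⇐ BetaPertH ∧ nine spine estimates (0/9
proved); BetaPertH ⇐ (D1) ∧ (D4) ∧ CAP+tail; G-an2-4 gates asym, D1 and NE2/3/4.»
-/

open scoped BigOperators

namespace Summit.QuantumFields.YangMills.Theorems.BalabanUVNodesK1ZeroHistoryRowsOfU2Letters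

open Literature.MathematicalPhysics.QuantumFieldTheory.Balaban1983to89
open Literature.MathematicalPhysics.QuantumFieldTheory.Balaban1983to89.FlowStep (HBeta prefixOf Box RGEqH)
open Literature.MathematicalPhysics.QuantumFieldTheory.Balaban1983to89.T4Continuum (T4Family)
open Literature.MathematicalPhysics.QuantumFieldTheory.Balaban1983to89.T4CouplingMatching (HistLipschitz FadingMemory ScaleShiftRate)
open Literature.MathematicalPhysics.QuantumFieldTheory.Balaban1983to89.T4BetaStationary (betaInf)
open Summit.QuantumFields.YangMills.Theorems.BalabanUVNodesK1R8RowsDefs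
open Summit.QuantumFields.BalabanUV.Beta.EriceFlowEnclosureB12AsPrintedPointwiseFadingZeroHistory (exists_zeroHist)
open Summit.QuantumFields.BalabanUV.Beta.EriceFlowEnclosureB12AsPrintedPointwiseFadingZeroHistoryBoundary (rowsTriple_of_histNegSummable rows_at_level_of_moduli_NE4')
open Summit.QuantumFields.BalabanUV.Beta.EriceFlowEnclosureB12AsPrintedPointwiseFadingRunRowsNecessity (bstar_nonneg_of_rowsTriple)

noncomputable section

variable {F : T4Family}

/-- **(δ) THE BOUNDARY ROAD TO `RunRowsCont13 F θ`.**  At a Stage-13 tuple θ let `β_θ := Node00.betaOfRecord₁₃ F 2 θ.toStage13Params` carry node U2's `HistLipschitz Λ γ β_θ` + `FadingMemory C ρ Λ` +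
NE4 `ScaleShiftRate c ρ γ β_θ` (0 ≤ ρ < 1, 0 ≤ C, 0 < γ), part 13's zero-history values `b⁰` (`hb0`) and part 11's asymptotic constant `b⋆` (`hb`) with **`0 ≤ b⋆` — zero allowed**; if on a box
`0 < δ ≤ γ` the HISTORY TERM has a summable negative envelope (`β_θ,k+1(v) − b⁰_k ≥ −e_k` for k ≥ k₀, `e ≥ 0`, `Σ_{[k₀,n)} e ≤ E`), then DEF-1's rows `RunRowsCont13 F θ` hold, witnessed at level δ
with `b k := β_θ,k+1(δ,…,δ)`, `r := Cδ∕(1−ρ)`, `M := k₀(|b⋆| + 2Cδ∕(1−ρ) + c∕(1−ρ)) + c∕(1−ρ)² + E` (part 13b's `rowsTriple_of_histNegSummable`).  CONDITIONAL on the letters at θ.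
[cite: Balaban1987RG1, Thm 2 p.259, Thm 3 p.264, §1 pp.263–264, (2.14) p.268, (5.10) p.293, §5 p.298] -/
theorem runRowsCont13_of_histNegSummable (θ : Node00.Stage13HParams F 2) {γ C c ρ : ℝ} {Λ : ℕ → ℕ → ℝ}
    (hL : HistLipschitz Λ γ (Node00.betaOfRecord₁₃ F 2 θ.toStage13Params)) (hΛ : FadingMemory C ρ Λ)
    (hS : ScaleShiftRate c ρ γ (Node00.betaOfRecord₁₃ F 2 θ.toStage13Params)) (hρ0 : 0 ≤ ρ) (hρ1 : ρ < 1) (hC : 0 ≤ C) (hγ : 0 < γ)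
    {b0 : ℕ → ℝ} (hb0 : ∀ (k : ℕ) (u : ℝ), 0 < u → u ≤ γ →
      |Node00.betaOfRecord₁₃ F 2 θ.toStage13Params k (fun _ : Fin (k + 1) => u) - b0 k| ≤ C * u / (1 - ρ))
    {bstar : ℝ} (hb : ∀ u : ℝ, 0 < u → u ≤ γ →
      |betaInf (Node00.betaOfRecord₁₃ F 2 θ.toStage13Params) (fun _ : ℕ => u) - bstar| ≤ C * u / (1 - ρ)) (hbstar : 0 ≤ bstar)
    {δ : ℝ} (hδ : 0 < δ) (hδγ : δ ≤ γ) {e : ℕ → ℝ} {E : ℝ} {k₀ : ℕ}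
    (hneg : ∀ (k : ℕ) (v : Fin (k + 1) → ℝ), k₀ ≤ k → v ∈ Box δ k → -e k ≤ Node00.betaOfRecord₁₃ F 2 θ.toStage13Params k v - b0 k)
    (he : ∀ k, 0 ≤ e k) (hE : ∀ n, ∑ k ∈ Finset.Ico k₀ n, e k ≤ E) :
    RunRowsCont13 F θ := by
  obtain ⟨b, r, γ₀, M, hγ₀, -, hi, hiv, hC'⟩ :=
    rowsTriple_of_histNegSummable hL hΛ hS hρ0 hρ1 hC hγ hb0 hb hbstar hδ hδγ hneg he hE
  exact (runRowsCont13_iff_inline F θ).mpr ⟨b, r, γ₀, M, hγ₀, hi, hiv, hC'⟩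

/-- **(δ₀) THE ONE-SIDED (AF-1) ROAD** — the case `e ≡ 0` of (δ): if `β_θ` is MINIMISED AT THE ZERO HISTORY from scale k₀ on the box ]0, δ] (`b⁰_k ≤ β_θ,k+1(v)`), then under the letters with
`0 ≤ b⋆` the rows hold.  This is the weakest sign-type letter on the β-functions that carries the deciding crux's rows ACROSS the boundary `b⋆ = 0` (part 13c: without it both outcomes occur).
CONDITIONAL. [cite: Balaban1987RG1, Thm 2 p.259, (2.14) p.268, §5 p.298] -/
theorem runRowsCont13_of_minimisedAtZero (θ : Node00.Stage13HParams F 2) {γ C c ρ : ℝ} {Λ : ℕ → ℕ → ℝ}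
    (hL : HistLipschitz Λ γ (Node00.betaOfRecord₁₃ F 2 θ.toStage13Params)) (hΛ : FadingMemory C ρ Λ)
    (hS : ScaleShiftRate c ρ γ (Node00.betaOfRecord₁₃ F 2 θ.toStage13Params)) (hρ0 : 0 ≤ ρ) (hρ1 : ρ < 1) (hC : 0 ≤ C) (hγ : 0 < γ)
    {b0 : ℕ → ℝ} (hb0 : ∀ (k : ℕ) (u : ℝ), 0 < u → u ≤ γ →
      |Node00.betaOfRecord₁₃ F 2 θ.toStage13Params k (fun _ : Fin (k + 1) => u) - b0 k| ≤ C * u / (1 - ρ))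
    {bstar : ℝ} (hb : ∀ u : ℝ, 0 < u → u ≤ γ →
      |betaInf (Node00.betaOfRecord₁₃ F 2 θ.toStage13Params) (fun _ : ℕ => u) - bstar| ≤ C * u / (1 - ρ)) (hbstar : 0 ≤ bstar)
    {δ : ℝ} (hδ : 0 < δ) (hδγ : δ ≤ γ) {k₀ : ℕ}
    (hmin : ∀ (k : ℕ) (v : Fin (k + 1) → ℝ), k₀ ≤ k → v ∈ Box δ k → b0 k ≤ Node00.betaOfRecord₁₃ F 2 θ.toStage13Params k v) :
    RunRowsCont13 F θ :=
  runRowsCont13_of_histNegSummable θ hL hΛ hS hρ0 hρ1 hC hγ hb0 hb hbstar hδ hδγ (e := fun _ => 0) (E := 0)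
    (fun k v hk hv => by have := hmin k v hk hv; linarith) (fun _ => le_rfl) (fun n => by simp)

/-- **(β′) THE NE4 ROAD ON THE DOUBLED LEVEL, WITH THE INTRINSIC REMAINDER SEQUENCE.**  Under the moduli + NE4 + `b⋆` (`hb`), at ANY level `0 < δ ≤ γ` with **`Cδ ≤ b⋆(1−ρ)`** (gen 50's
`runRowsCont13_of_moduli_NE4_at_level` needs `2Cδ ≤ b⋆(1−ρ)`): `RunRowsCont13 F θ`, witnessed at δ with `b := b⁰` (the record's zero-history values, ONE sequence for every level, radius `Cδ∕(1−ρ)`)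
and `M := c∕(1−ρ)²` (part 13b's `rows_at_level_of_moduli_NE4'`; `b⁰` from part 13's `exists_zeroHist`).  CONDITIONAL. [cite: Balaban1987RG1, Thm 2 p.259, Thm 3 p.264, §1 pp.263–264, (5.10) p.293, §5 p.298] -/
theorem runRowsCont13_of_moduli_NE4_at_level' (θ : Node00.Stage13HParams F 2) {γ C c ρ : ℝ} {Λ : ℕ → ℕ → ℝ}
    (hL : HistLipschitz Λ γ (Node00.betaOfRecord₁₃ F 2 θ.toStage13Params)) (hΛ : FadingMemory C ρ Λ)
    (hS : ScaleShiftRate c ρ γ (Node00.betaOfRecord₁₃ F 2 θ.toStage13Params)) (hρ0 : 0 ≤ ρ) (hρ1 : ρ < 1) (hC : 0 ≤ C) (hγ : 0 < γ)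
    {bstar : ℝ} (hb : ∀ u : ℝ, 0 < u → u ≤ γ →
      |betaInf (Node00.betaOfRecord₁₃ F 2 θ.toStage13Params) (fun _ : ℕ => u) - bstar| ≤ C * u / (1 - ρ))
    {δ : ℝ} (hδ : 0 < δ) (hδγ : δ ≤ γ) (hsmall : C * δ ≤ bstar * (1 - ρ)) :
    RunRowsCont13 F θ := by
  obtain ⟨b0, hb0⟩ := exists_zeroHist hL hΛ hρ0 hρ1 hC hγ
  obtain ⟨hi, hiv, hC'⟩ := rows_at_level_of_moduli_NE4' hL hΛ hS hρ0 hρ1 hC hγ hb0 hb hδ hδγ hsmall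
  exact (runRowsCont13_iff_inline F θ).mpr ⟨b0, C * δ / (1 - ρ), δ, c / (1 - ρ) ^ 2, hδ, hi, hiv, hC'⟩

/-- **(ν) THE PRICE AT THE TUPLE: `RunRowsCont13 F θ` FORCES `0 ≤ b⋆`.**  If the record's β at θ carries the moduli + NE4 and part 11's asymptotic constant `b⋆` (`hb`), then DEF-1's rows at θ
(at whatever level they are witnessed) force `0 ≤ b⋆` — part 12d's `bstar_nonneg_of_rowsTriple` read through `runRowsCont13_iff_inline` (only row (iv) is used: for `b⋆ < 0` the deep survivor
violates every run-wise floor).  With gen 50's `runRowsCont13_of_moduli_NE4_bstar_pos` (`0 < b⋆` sufficient) and (δ) above (at `b⋆ = 0` a one-sided history letter suffices; part 13c: nothing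
coarser does): THE DECIDING CRUX'S ROWS, PRICED AT THE TUPLE IN THE β-FLOW TEAM'S ONE NUMBER.  CONDITIONAL on the letters. [cite: Balaban1987RG1, Thm 2 p.259, Thm 3 p.264, (5.10) p.293, §5 p.298] -/
theorem bstar_nonneg_of_runRowsCont13 (θ : Node00.Stage13HParams F 2) {γ C c ρ : ℝ} {Λ : ℕ → ℕ → ℝ}
    (hL : HistLipschitz Λ γ (Node00.betaOfRecord₁₃ F 2 θ.toStage13Params)) (hΛ : FadingMemory C ρ Λ)
    (hS : ScaleShiftRate c ρ γ (Node00.betaOfRecord₁₃ F 2 θ.toStage13Params)) (hρ0 : 0 ≤ ρ) (hρ1 : ρ < 1) (hC : 0 ≤ C) (hγ : 0 < γ)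
    {bstar : ℝ} (hb : ∀ u : ℝ, 0 < u → u ≤ γ →
      |betaInf (Node00.betaOfRecord₁₃ F 2 θ.toStage13Params) (fun _ : ℕ => u) - bstar| ≤ C * u / (1 - ρ))
    (hrows : RunRowsCont13 F θ) : 0 ≤ bstar :=
  bstar_nonneg_of_rowsTriple hL hΛ hS hρ0 hρ1 hC hγ hb ((runRowsCont13_iff_inline F θ).mp hrows)

/-- **… so `b⋆ < 0` REFUTES the rows at θ** (contrapositive; under the letters). [cite: Balaban1987RG1, Thm 2 p.259 and §5 p.298] -/
theorem not_runRowsCont13_of_bstar_neg (θ : Node00.Stage13HParams F 2) {γ C c ρ : ℝ} {Λ : ℕ → ℕ → ℝ}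
    (hL : HistLipschitz Λ γ (Node00.betaOfRecord₁₃ F 2 θ.toStage13Params)) (hΛ : FadingMemory C ρ Λ)
    (hS : ScaleShiftRate c ρ γ (Node00.betaOfRecord₁₃ F 2 θ.toStage13Params)) (hρ0 : 0 ≤ ρ) (hρ1 : ρ < 1) (hC : 0 ≤ C) (hγ : 0 < γ)
    {bstar : ℝ} (hb : ∀ u : ℝ, 0 < u → u ≤ γ →
      |betaInf (Node00.betaOfRecord₁₃ F 2 θ.toStage13Params) (fun _ : ℕ => u) - bstar| ≤ C * u / (1 - ρ)) (hneg : bstar < 0) :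
    ¬ RunRowsCont13 F θ :=
  fun h => absurd (bstar_nonneg_of_runRowsCont13 θ hL hΛ hS hρ0 hρ1 hC hγ hb h) (not_le.mpr hneg)

end

end Summit.QuantumFields.YangMills.Theorems.BalabanUVNodesK1ZeroHistoryRowsOfU2Letters
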